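import Summits.ResolutionOfSingularities.ResolutionOfSingularities.Theorems.MaxContactCutExitLaw
import Literature.AlgebraicGeometry.Resolution.PointBlowupIFPGiraudChain
import Literature.AlgebraicGeometry.Resolution.PointBlowupFlagTranslatedStep
import Literature.AlgebraicGeometry.CossartPiltant200819.KappaCases2009
import HarnessLib

/-!
# DifferentialShade — decomp-res lens-5 g19 companion «DifferentialShadeSettles» of the node «CoefficientCut»
(aside 31770): the Kawanoue–Matsuki
differential shade `μ̃` of the transported Hasse family SETTLES along every forced walk from a root (kernel, every
`e`, every field of char `p`).

Content VERBATIM from the decomp-res lens-5 g19 companion file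
`HOME/decomp-res-lens-5/g19/DifferentialShadeSettles.lean` (sha256 42365850c0cfaa77 ≡
`parts/DifferentialShadeSettles-42365850.lean`, 305 l).  Critic: CRITIC-LEDGER row 135a (COMPANION MAP +1; farm rc 0
· 0 sorry · std axioms),
landing order 2026-08-30T19:36:14Z: it SUPERSEDES the unlanded g18 companion `DifferentialShade` db68ab60 (same
definitions; the g18 support
statement `DifferentialShadeSettles` is now a THEOREM).  No separate «stalled» aside: the ONE located-residual
aside of 31770's joint part is
`CoefficientCut.NoSkewJointTailsDeep` (row 135).

## The lens's description (VERBATIM)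

# DifferentialShadeSettles — decomp-res lens-5, generation 19, companion of «CoefficientCut»

THE CRITIC'S MAP TARGET (row 129: «DifferentialShadeSettles proved in kernel, joint_iff_stalled hypothesis-free»).
Generation 18's companion `DifferentialShade.lean` proved that the Kawanoue–Matsuki differential shade
`μ̃_t = μ_P − Σ_{D ∈ E_young} μ_{P,D}` of the TRANSPORTED Hasse family `ifp W t` never increases along any forced walk
from a root (`muTilde_succ_le`, from the tree's `IFPState.muTilde_succ_le_along`), and left as a SUPPORT STATEMENT the
settling of `μ̃` (`DifferentialShadeSettles`: «`μ̃` is eventually constant on every root walk»), modulo which the tree's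
joint residual `ExitLaw.NoRepeatTranslationRecurrentExcessPlateauxDeep` is EXACTLY its stalled part
(`joint_iff_stalled (hset : DifferentialShadeSettles)`).

THIS FILE PROVES THE SUPPORT STATEMENT (kernel, tree imports only, every `e`, every field of characteristic `p`):
* `muTilde_lattice` — for a corner state whose carried levels `q − |J|` lie in `[1, q−1]`, `μ̃` is `⊤` or a
  NON-NEGATIVE rational with denominator dividing `(q−1)!`: `μ̃ = z / (q−1)!`, `z ∈ ℕ` (the minimising generator's
  minimal monomial `u^{d⋆}` bounds every `μ_{P,D_i}` by `d⋆_i / a₀`, and `Σ_i d⋆_i = |d⋆| = ord`; each `μ_{P,D}` is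
  attained at a carried index, so it is `n/a` with `a ∣ (q−1)!`);
* `muTilde_settles` — hence along every forced walk from a root `t ↦ μ̃_t` (antitone, `DifferentialShade` g18) is
  eventually constant: either `⊤` for ever, or from the first finite time on a non-increasing sequence in `(1/(q−1)!)·ℕ`;
* the class `DifferentialShadeSettles` (VERBATIM the g18 support statement) is now a theorem
  (`differentialShadeSettles_holds`), so `joint_iff_stalled` holds HYPOTHESIS-FREE and
  `defectWalksDeep_iff_stalled : MaxContactCut.DefectWalksDeep ↔ NoFreePointTailsDeep ∧ NoStalledRepeat…Deep` is EXACT: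
  the lens-5 joint residual lives inside Kawanoue–Matsuki's «Case: μ̃ stays the same» (IFP dim 3, arXiv:1205.4556 §4.1),
  for every `e ≥ 2`, with no support statement left.
§0 repeats the g18 transport `ifp` and `muTilde_succ_le` (HOME files cannot be imported) so that this file compiles alone.

[WRITER NOTE (decomp-res writer g7): one tree file, namespace as in the lens; global `set_option` line dropped; the
lens's private copy `nat_eventually_const` of the landed Literature lemma
`CossartPiltant200819.KappaCases2009.eventually_const_of_succ_le` deleted and the landed one cited (gate
dedup.landed); nothing else changed.]

(Sources: KawanoueMatsuki2016 §4.1 (arXiv:1205.4556); BenitoVillamayor2012; Hauser2010; CossartJannsenSaito2020.)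
-/

noncomputable section

open MvPolynomial Finset
open Literature.AlgebraicGeometry.Resolution
open Literature.AlgebraicGeometry.Resolution.Hauser2010
open Literature.AlgebraicGeometry.Resolution.PointBlowup
open Summit.ResolutionOfSingularities.ResolutionOfSingularities.Theses
open Summit.ResolutionOfSingularities.ResolutionOfSingularities.Theorems.TightDefectClasses
open Summit.ResolutionOfSingularities.ResolutionOfSingularities.Theorems.ProximityCut
open Summit.ResolutionOfSingularities.ResolutionOfSingularities.Theorems.ExitLaw
open Literature.AlgebraicGeometry.CossartPiltant200819.KappaCases2009 (eventually_const_of_succ_le)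

namespace Summit.ResolutionOfSingularities.ResolutionOfSingularities.Theorems.DifferentialShade

/-! ## §0 The transported family along a forced walk (as in generation 18) -/

section Walk

variable {K : Type} [Field K] [DecidableEq K] {q : ℕ} {s₀ : State (Fin 3) K}

/-- The Kawanoue–Matsuki corner states TRANSPORTED along a forced walk. (Sources: KawanoueMatsuki2016, §4.1.) -/
noncomputable def ifp (W : ForcedWalk q s₀) : ℕ → IFPState (Fin 3) K
  | 0 => IFPState.init q s₀.F
  | t + 1 => (ifp W t).step q (W.j t) (W.b t)

/-- `ifp_zero`: Auxiliary step of this node's calculus, VERBATIM from the lens file (see the module docstring); the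
statement is its type. [folklore] -/
@[simp] theorem ifp_zero (W : ForcedWalk q s₀) : ifp W 0 = IFPState.init q s₀.F := rfl

/-- `ifp_succ`: Auxiliary step of this node's calculus, VERBATIM from the lens file (see the module docstring); the
statement is its type. [folklore] -/
@[simp] theorem ifp_succ (W : ForcedWalk q s₀) (t : ℕ) :
    ifp W (t + 1) = (ifp W t).step q (W.j t) (W.b t) := rfl

/-- The carried index set never changes along the walk. [folklore] -/
theorem idx_ifp (W : ForcedWalk q s₀) (t : ℕ) : (ifp W t).idx = IFPState.derivIndices q s₀.F := by
  induction t with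
  | zero => rfl
  | succ t ih => simpa [ifp_succ, IFPState.step] using ih

/-- Every carried level `q − |J|` lies in `[1, q − 1]`. [folklore] -/
theorem level_bounds (W : ForcedWalk q s₀) (t : ℕ) :
    ∀ J ∈ (ifp W t).idx, 0 < J.degree ∧ J.degree < q := by
  rw [idx_ifp]
  exact fun J hJ => IFPState.degree_lt_of_mem_derivIndices hJ

/-- The differential shade never increases along a forced walk from a root (g18, from the tree's
`IFPState.muTilde_succ_le_along`). (Sources: KawanoueMatsuki2016, Proposition 4 (2).) -/
theorem muTilde_succ_le {p e : ℕ} (hp : p.Prime) [CharP K p] {s₀ : State (Fin 3) K} (hs : IsRoot (p ^ e) s₀)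
    (W : ForcedWalk (p ^ e) s₀) (t : ℕ) :
    (ifp W (t + 1)).muTilde (p ^ e) ≤ (ifp W t).muTilde (p ^ e) := by
  haveI : Fact p.Prime := ⟨hp⟩
  have h0 : (W.st 0).F = s₀.F := by rw [W.st_zero]
  exact IFPState.muTilde_succ_le_along p e W.st (ifp W) W.j W.b W.onExc W.st_succ (fun n => rfl)
    (by rw [h0]; rfl) (by rw [h0]; exact hs.2.2) W.equimult t

/-- `muTilde_antitone`: Auxiliary step of this node's calculus, VERBATIM from the lens file (see the module
docstring); the statement is its type. [folklore] -/
theorem muTilde_antitone {p e : ℕ} (hp : p.Prime) [CharP K p] {s₀ : State (Fin 3) K} (hs : IsRoot (p ^ e) s₀)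
    (W : ForcedWalk (p ^ e) s₀) : Antitone fun t => (ifp W t).muTilde (p ^ e) :=
  antitone_nat_of_succ_le fun t => muTilde_succ_le hp hs W t

end Walk

/-! ## §1 The lattice of values of `μ̃` -/

section Lattice

variable {σ : Type} [Fintype σ] {K : Type} [Field K]

/-- **`μ̃ ∈ (1/(q−1)!)·ℕ ∪ {⊤}`.**  For a corner state whose carried levels lie in `[1, q−1]`, the
differential shade
is `⊤` or `z/(q−1)!` with `z ∈ ℕ`: every `μ_P`, `μ_{P,D}` is attained at a carried index (a ratio `n/a`,
`a ∣ (q−1)!`),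
and `Σ_{D young} μ_{P,D} ≤ μ_P` because the minimal monomial `u^{d⋆}` of the minimising generator has
`Σ_i d⋆_i = |d⋆|`. (Sources: KawanoueMatsuki2016, §4.1 (μ̃ is a non-negative rational number with bounded
denominator).) -/
theorem muTilde_lattice (q : ℕ) (s : IFPState σ K) (hlev : ∀ J ∈ s.idx, 0 < J.degree ∧ J.degree < q) :
    s.muTilde q = ⊤ ∨
      ∃ z : ℕ, s.muTilde q = ((((z : ℚ) / ((q - 1).factorial : ℕ)) : ℚ) : WithTop ℚ) := by
  classical
  by_cases htop : s.muP q = ⊤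
  · left; unfold IFPState.muTilde; rw [htop]; rfl
  right
  set L : ℕ := (q - 1).factorial with hL
  have hLpos : 0 < L := Nat.factorial_pos _
  have hLq : (0 : ℚ) < L := by exact_mod_cast hLpos
  have hdvd : ∀ J ∈ s.idx, (q - J.degree) ∣ L := fun J hJ =>
    Nat.dvd_factorial (by have := hlev J hJ; omega) (by have := hlev J hJ; omega)
  -- the minimising index of μ_P, its generator, level and order
  obtain ⟨J₀, hJ₀, hμ⟩ := IFPState.exists_muP_eq q s htop
  set g₀ := s.gen J₀ with hg₀
  set a₀ : ℕ := q - J₀.degree with ha₀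
  have hg₀ne : g₀ ≠ 0 := by
    intro h0
    apply htop
    rw [hμ, h0, ordZero_zero]
    rfl
  have ha₀pos : 0 < a₀ := by have := (hlev J₀ hJ₀).2; omega
  have ha₀q : (0 : ℚ) < a₀ := by exact_mod_cast ha₀pos
  obtain ⟨d₀, hd₀⟩ := exists_ordZero_eq_natCast hg₀ne
  have hμval : s.muP q = (((d₀ : ℚ) / a₀ : ℚ) : WithTop ℚ) := by rw [hμ, hd₀]; rfl
  -- a minimal monomial of g₀
  obtain ⟨⟨dstar, hdstar, hdstardeg⟩, -⟩ := HauserPerlega2024.exists_mem_support_degree_eq hd₀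
  -- every μ_{P,D_i} is a ratio n/a with a ∣ L, bounded by d⋆_i / a₀
  have hPD : ∀ i : σ, ∃ n a : ℕ, 0 < a ∧ a ∣ L ∧
      s.muPD q i = ((((n : ℚ) / a) : ℚ) : WithTop ℚ) ∧ (n : ℚ) / a ≤ (dstar i : ℚ) / a₀ := by
    intro i
    obtain ⟨Ji, hJi, hJieq⟩ := Finset.exists_mem_eq_inf s.idx ⟨J₀, hJ₀⟩
      (fun J => levelRatio (divisorOrder i (s.gen J)) (q - J.degree))
    have hμi : s.muPD q i = levelRatio (divisorOrder i (s.gen Ji)) (q - Ji.degree) := hJieq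
    have hbound : s.muPD q i ≤ (((dstar i : ℚ) / a₀ : ℚ) : WithTop ℚ) := by
      calc s.muPD q i ≤ levelRatio (divisorOrder i g₀) a₀ := Finset.inf_le hJ₀
        _ ≤ levelRatio ((dstar i : ℕ) : ℕ∞) a₀ := levelRatio_mono (divisorOrder_le_exponent hdstar) a₀
        _ = _ := levelRatio_natCast _ _
    have hfin : divisorOrder i (s.gen Ji) ≠ ⊤ := by
      intro htop'
      rw [hμi, htop', levelRatio_top] at hbound
      exact WithTop.not_top_le_coe _ hbound
    obtain ⟨n, hn⟩ := ENat.ne_top_iff_exists.mp hfin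
    refine ⟨n, q - Ji.degree, by have := hlev Ji hJi; omega, hdvd Ji hJi, ?_, ?_⟩
    · rw [hμi, ← hn]; rfl
    · have h := hbound
      rw [hμi, ← hn, levelRatio_natCast, WithTop.coe_le_coe] at h
      exact h
  choose n a hapos hadvd hval hle using hPD
  -- unfold μ̃
  have hu : ∀ i, (s.muPD q i).untopD 0 = (n i : ℚ) / a i := by
    intro i; rw [hval i]; rfl
  have hμt : s.muTilde q = ((((d₀ : ℚ) / a₀ - ∑ i ∈ s.young, (n i : ℚ) / a i) : ℚ) : WithTop ℚ) := by
    unfold IFPState.muTilde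
    rw [hμval]
    show ((((d₀ : ℚ) / a₀ - ∑ i ∈ s.young, (s.muPD q i).untopD 0) : ℚ) : WithTop ℚ) = _
    simp_rw [hu]
  -- the young sum is at most μ_P
  have hsum_le : ∑ i ∈ s.young, (n i : ℚ) / a i ≤ (d₀ : ℚ) / a₀ := by
    calc ∑ i ∈ s.young, (n i : ℚ) / a i ≤ ∑ i ∈ s.young, (dstar i : ℚ) / a₀ :=
          Finset.sum_le_sum fun i _ => hle i
      _ ≤ ∑ i, (dstar i : ℚ) / a₀ :=
          Finset.sum_le_sum_of_subset_of_nonneg (Finset.subset_univ _)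
            (fun i _ _ => div_nonneg (Nat.cast_nonneg _) (Nat.cast_nonneg _))
      _ = (d₀ : ℚ) / a₀ := by
          rw [← Finset.sum_div, ← hdstardeg, Finsupp.degree_eq_sum]
          push_cast
          rfl
  -- integrality: L · (n i / a i) ∈ ℕ and L · (d₀ / a₀) ∈ ℕ
  have hterm : ∀ i, (n i : ℚ) / a i = ((n i * (L / a i) : ℕ) : ℚ) / L := by
    intro i
    have ha : (a i : ℚ) ≠ 0 := by exact_mod_cast (hapos i).ne'
    rw [Nat.cast_mul, Nat.cast_div (hadvd i) ha]
    field_simp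
  have hdv₀ : a₀ ∣ L := hdvd J₀ hJ₀
  have hterm₀ : (d₀ : ℚ) / a₀ = ((d₀ * (L / a₀) : ℕ) : ℚ) / L := by
    have ha : (a₀ : ℚ) ≠ 0 := ha₀q.ne'
    rw [Nat.cast_mul, Nat.cast_div hdv₀ ha]
    field_simp
  set Z₀ : ℕ := d₀ * (L / a₀) with hZ₀
  set Zs : ℕ := ∑ i ∈ s.young, n i * (L / a i) with hZs
  have hsumZ : ∑ i ∈ s.young, (n i : ℚ) / a i = (Zs : ℚ) / L := by
    rw [hZs, Nat.cast_sum, Finset.sum_div]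
    exact Finset.sum_congr rfl fun i _ => by rw [hterm i, Nat.cast_mul]
  have hZle : Zs ≤ Z₀ := by
    have h := hsum_le
    rw [hsumZ, hterm₀] at h
    have := (div_le_div_iff_of_pos_right hLq).mp h
    exact_mod_cast this
  refine ⟨Z₀ - Zs, ?_⟩
  rw [hμt, hsumZ, hterm₀, Nat.cast_sub hZle, sub_div]

end Lattice

/-! ## §2 Settling -/

section Settle

variable {K : Type} [Field K] [DecidableEq K]

/-- **The differential shade SETTLES** along every forced walk from a root: `t ↦ μ̃_t` is eventually constant.
(Sources: KawanoueMatsuki2016, §4.1 (μ̃ ∈ (1/N)·ℤ_{≥0} ∪ {∞} does not increase).) -/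
theorem muTilde_settles {p e : ℕ} (hp : p.Prime) [CharP K p] {s₀ : State (Fin 3) K} (hs : IsRoot (p ^ e) s₀)
    (W : ForcedWalk (p ^ e) s₀) :
    ∃ N : ℕ, ∀ t, N ≤ t → (ifp W (t + 1)).muTilde (p ^ e) = (ifp W t).muTilde (p ^ e) := by
  classical
  have hLq : (0 : ℚ) < ((p ^ e - 1).factorial : ℕ) := by exact_mod_cast Nat.factorial_pos _
  have hanti := muTilde_antitone hp hs W
  have hlat : ∀ t, (ifp W t).muTilde (p ^ e) = ⊤ ∨
      ∃ z : ℕ, (ifp W t).muTilde (p ^ e) = ((((z : ℚ) / ((p ^ e - 1).factorial : ℕ)) : ℚ) : WithTop ℚ) :=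
    fun t => muTilde_lattice (p ^ e) (ifp W t) (level_bounds W t)
  by_cases hall : ∀ t, (ifp W t).muTilde (p ^ e) = ⊤
  · exact ⟨0, fun t _ => by rw [hall (t + 1), hall t]⟩
  push Not at hall
  obtain ⟨t₀, ht₀⟩ := hall
  have hfin : ∀ t, t₀ ≤ t → (ifp W t).muTilde (p ^ e) ≠ ⊤ := by
    intro t ht htop
    have h1 : (ifp W t).muTilde (p ^ e) ≤ (ifp W t₀).muTilde (p ^ e) := hanti ht
    rw [htop, top_le_iff] at h1
    exact ht₀ h1
  have hz : ∀ m : ℕ, ∃ z : ℕ,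
      (ifp W (t₀ + m)).muTilde (p ^ e) = ((((z : ℚ) / ((p ^ e - 1).factorial : ℕ)) : ℚ) : WithTop ℚ) := by
    intro m
    rcases hlat (t₀ + m) with h | h
    · exact absurd h (hfin _ (Nat.le_add_right _ _))
    · exact h
  choose g hg using hz
  have hgmono : ∀ m, g (m + 1) ≤ g m := by
    intro m
    have h1 : (ifp W (t₀ + (m + 1))).muTilde (p ^ e) ≤ (ifp W (t₀ + m)).muTilde (p ^ e) := hanti (by omega)
    rw [hg, hg, WithTop.coe_le_coe] at h1
    have h2 := (div_le_div_iff_of_pos_right hLq).mp h1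
    exact_mod_cast h2
  obtain ⟨m₀, hm₀⟩ := eventually_const_of_succ_le g hgmono
  refine ⟨t₀ + m₀, fun t ht => ?_⟩
  obtain ⟨m, rfl⟩ : ∃ m, t = t₀ + m := ⟨t - t₀, by omega⟩
  rw [show t₀ + m + 1 = t₀ + (m + 1) from rfl, hg, hg, hm₀ (m + 1) (by omega), hm₀ m (by omega)]

end Settle

/-! ## §3 Classes: the support statement is a theorem; the stalled residual is EXACT -/

section Classes

/-- **DECIDED (PROVED here, every `e`):** the differential shade SETTLES — on every forced walk from a root it is
eventually constant.  VERBATIM the generation-18 support statement. (Sources: KawanoueMatsuki2016, §4.1.) -/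
def DifferentialShadeSettles : Prop :=
  ∀ p : ℕ, p.Prime → ∀ e : ℕ, ∀ (K : Type) [Field K] [CharP K p] [DecidableEq K]
    (s₀ : State (Fin 3) K), IsRoot (p ^ e) s₀ → ∀ W : ForcedWalk (p ^ e) s₀,
    ∃ N : ℕ, ∀ t, N ≤ t → (ifp W (t + 1)).muTilde (p ^ e) = (ifp W t).muTilde (p ^ e)

/-- `differentialShadeSettles_holds`: Auxiliary step of this node's calculus, VERBATIM from the lens file (see the
module docstring); the statement is its type. [folklore] -/
theorem differentialShadeSettles_holds : DifferentialShadeSettles :=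
  fun _ hp _ _ _ _ _ _ hs W => muTilde_settles hp hs W

/-- **LOCATED RESIDUAL (UNDECIDED):** the tree's joint residual with the extra binder «every move from `N` on is a
STALL of the differential shade» — Kawanoue–Matsuki's «Case: μ̃ stays the same» (VERBATIM the g18 class).  [new] -/
def NoStalledRepeatTranslationRecurrentExcessPlateauxDeep : Prop :=
  ∀ p : ℕ, p.Prime → ∀ e : ℕ, 2 ≤ e → ∀ (K : Type) [Field K] [CharP K p] [PerfectField K] [DecidableEq K]
    (s₀ : State (Fin 3) K), IsRoot (p ^ e) s₀ → ∀ W : ForcedWalk (p ^ e) s₀, (∀ i, 1 ≤ (W.st i).shade) →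
    ∀ N : ℕ, (∀ t, N ≤ t → (W.st (t + 1)).shade = (W.st t).shade) →
    (∀ t, N ≤ t → ordZero (W.st t).F ≠ ((p ^ e : ℕ) : ℕ∞)) →
    (∀ M : ℕ, ∃ t, M ≤ t ∧ StaysOnNewest W t) → (∀ M : ℕ, ∃ t, M ≤ t ∧ W.b t ≠ 0) →
    (∀ t, N ≤ t → (ifp W (t + 1)).muTilde (p ^ e) = (ifp W t).muTilde (p ^ e)) → False

/-- Trivial direction. [folklore] -/
theorem stalled_of_joint (h : NoRepeatTranslationRecurrentExcessPlateauxDeep) :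
    NoStalledRepeatTranslationRecurrentExcessPlateauxDeep :=
  fun p hp e he K _ _ _ _ s₀ hs W hsh N hplat hexc hS hT _ => h p hp e he K s₀ hs W hsh N hplat hexc hS hT

/-- **Relocation, hypothesis-free:** shift `N` past the settling time of `μ̃` (`muTilde_settles`). [folklore] -/
theorem joint_of_stalled (h : NoStalledRepeatTranslationRecurrentExcessPlateauxDeep) :
    NoRepeatTranslationRecurrentExcessPlateauxDeep := by
  intro p hp e he K _ _ _ _ s₀ hs W hsh N hplat hexc hS hT
  obtain ⟨N₁, hN₁⟩ := muTilde_settles hp hs W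
  exact h p hp e he K s₀ hs W hsh (max N N₁) (fun t ht => hplat t (le_trans (le_max_left _ _) ht))
    (fun t ht => hexc t (le_trans (le_max_left _ _) ht)) hS hT
    (fun t ht => hN₁ t (le_trans (le_max_right _ _) ht))

/-- **EXACT:** the joint residual IS its stalled part. [folklore] -/
theorem joint_iff_stalled :
    NoRepeatTranslationRecurrentExcessPlateauxDeep ↔ NoStalledRepeatTranslationRecurrentExcessPlateauxDeep :=
  ⟨stalled_of_joint, joint_of_stalled⟩

/-- **Closing form BY NAME** (no support statement left). [folklore] -/
theorem closes_stalled (hA : NoFreePointTailsDeep) (hN : NoStalledRepeatTranslationRecurrentExcessPlateauxDeep) :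
    MaxContactCut.DefectWalksDeep :=
  defectWalksDeep_iff_joint'.mpr ⟨hA, joint_of_stalled hN⟩

/-- **EXACT node equation** for the lens-5 target through the stall regime. [folklore] -/
theorem defectWalksDeep_iff_stalled :
    MaxContactCut.DefectWalksDeep ↔ NoFreePointTailsDeep ∧ NoStalledRepeatTranslationRecurrentExcessPlateauxDeep := by
  rw [defectWalksDeep_iff_joint', joint_iff_stalled]

end Classes

end Summit.ResolutionOfSingularities.ResolutionOfSingularities.Theorems.DifferentialShade
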